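import Mathlib.MeasureTheory.Integral.IntervalIntegral.Basic
import Literature.Geometry.MetricEmbeddings.HeisenbergKoranyiLines
import HarnessLib

/-!
# Quantitative central collapse in the ideal case: cut measures supported on half-spaces

Family `pnp`, layer `Literature/Geometry/MetricEmbeddings`; sibling proofs file (theorems only).
Source: J. Cheeger, B. Kleiner, A. Naor, arXiv:0910.2026 = Acta Math. 207 (2011), §4 (arXiv
pp. 13–14): "We begin by considering an ideal case […] Let `d_𝒫` denote a cut metric for which the
cut measure is supported on cuts `𝒫` which are half-spaces. Let `ε > 0`. We will see by an easy
argument that for every affine line `L` which makes an angle `≥ θ > 0` with the horizontal plane,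
for a definite fraction of the pairs of points `x₁, x₂ ∈ L`, with `d^ℍ(x₁,x₂) = ε`, we have
`d_𝒫(x₁,x₂) ≲_θ ε · d^ℍ(x₁,x₂)` (4.1)" and its proof ("Proof of (4.1). Consider first an
elementary cut metric `d_E` on the real line, associated to a subset `E` such that `E` and `E′` are
connected. Clearly, if `x₃` lies between `x₁` and `x₂`, then `d_E(x₁,x₃) + d_E(x₃,x₂) = d_E(x₁,x₂)`.
By linearity, this holds more generally for cut metrics on the line whose cut measures are supported
on such cuts […] by the length space property of `d_𝒫` […]"). This is the mechanism behind
[CKN Thm. 1.1]: once the cuts of `f` are (close to) half-spaces, `f` must compress VERTICAL pairs,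
because along a vertical line `d^ℍ` is the square root of the parameter while `f` has additive,
hence linearly small on average, increments.

PROVED here (no named facts), for the `ℓ₁^N`-valued maps quantified over in
`CheegerKleinerNaor2011_wordBall_l1Distortion` (whose cut measure is carried by the super-level sets
of the coordinates, `CutConeIntegral.lean`) on the model `HeisK` (Cygan–Korányi metric `d_K`,
vertical lines `dist_mul_center`: `d_K(p, p·(0,0,c)) = 2√|c|`):

* `HeisK.integral_shift_sub_le_of_monotone`, `HeisK.integral_abs_shift_sub_le` — the
  sliding-window inequality `∫_a^{b−η} |G(h+η) − G(h)| dh ≤ η |G(b) − G(a)|` for monotone/antitone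
  `G` (the "length space property" in integrated form);
* `HeisK.idealCase_centralCollapse` — if `f : ℍ → ℓ₁^N` is `1`-Lipschitz for `d_K` on `B_1(1)` and
  every coordinate is a monotone or antitone function of an affine functional of the coordinates
  `(a,b,c) = (x, y, 2z−xy)` of [CKN] (equivalently: all super-level sets of all coordinates are
  half-spaces `HeisK.halfspace`, i.e. the cut measure is supported on half-spaces), then for every
  `ε ∈ (0, 1/4]` there is a vertical pair `(0,0,h), (0,0,h+ε²/4) ∈ B_1(1)` at distance exactly `ε`
  with `‖f(x₁) − f(x₂)‖₁ ≤ 4ε · d_K(x₁,x₂)` — compression by the factor `4ε` at scale `ε`, much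
  stronger than the `(log(1/ε))^{-δ}` of the general case (compare the hypothesis of
  `CheegerKleinerNaor2011_wordBall_l1Distortion.of_centralCollapse`).

* `HeisK.idealCase_centralCollapse_measure` — the "definite fraction" form: among the pairs
  `((0,0,h),(0,0,h+ε²/4))`, `h` in a window of length `≥ 7/64`, the parameters of the pairs NOT
  compressed by the factor `8ε` have measure `≤ 1/32` (Markov's inequality).

NOT here: the general case (cuts only CLOSE to half-spaces: [CKN Prop. 20] with the error control of
Lemma 17, and the stability theorem supplying such cuts), non-vertical lines `L`.

## References

* [CheegerKleinerNaor2011] J. Cheeger, B. Kleiner, A. Naor, Acta Math. 207 (2011) 291–373, §4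
  eq. (4.1) and its proof (arXiv:0910.2026 pp. 13–14).
-/

noncomputable section

open MeasureTheory Set

namespace Literature.Geometry.MetricEmbeddings

namespace HeisK

/-- **Sliding-window inequality** for a monotone function:
`∫_a^{b−η} (G(h+η) − G(h)) dh ≤ η (G(b) − G(a))` for `η ≥ 0`. [folklore] -/
theorem integral_shift_sub_le_of_monotone {G : ℝ → ℝ} (hG : Monotone G) {a b η : ℝ}
    (hη : 0 ≤ η) :
    ∫ h in a..(b - η), (G (h + η) - G h) ≤ η * (G b - G a) := by
  have hi : ∀ u v : ℝ, IntervalIntegrable G volume u v := fun u v => hG.intervalIntegrable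
  have hG' : Monotone fun h => G (h + η) := fun x y hxy => hG (by linarith)
  have hi' : ∀ u v : ℝ, IntervalIntegrable (fun h => G (h + η)) volume u v := fun u v =>
    hG'.intervalIntegrable
  rw [intervalIntegral.integral_sub (hi' _ _) (hi _ _), intervalIntegral.integral_comp_add_right,
    sub_add_cancel]
  have e1 : ∫ x in (a + η)..b, G x = (∫ x in (a + η)..a, G x) + ∫ x in a..b, G x :=
    (intervalIntegral.integral_add_adjacent_intervals (hi _ _) (hi _ _)).symm
  have e2 : ∫ x in a..(b - η), G x = (∫ x in a..b, G x) + ∫ x in b..(b - η), G x :=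
    (intervalIntegral.integral_add_adjacent_intervals (hi _ _) (hi _ _)).symm
  rw [e1, e2, intervalIntegral.integral_symm a (a + η), intervalIntegral.integral_symm (b - η) b]
  have hb : ∫ x in (b - η)..b, G x ≤ ∫ _ in (b - η)..b, G b :=
    intervalIntegral.integral_mono_on (by linarith) (hi _ _) (by simp) (fun x hx => hG hx.2)
  have ha : ∫ _ in a..(a + η), G a ≤ ∫ x in a..(a + η), G x :=
    intervalIntegral.integral_mono_on (by linarith) (by simp) (hi _ _) (fun x hx => hG hx.1)
  rw [intervalIntegral.integral_const, smul_eq_mul] at ha hb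
  have e3 : b - (b - η) = η := by ring
  have e4 : a + η - a = η := by ring
  rw [e3] at hb
  rw [e4] at ha
  linarith

/-- The sliding-window inequality in absolute value, for a function that is monotone or antitone:
`∫_a^{b−η} |G(h+η) − G(h)| dh ≤ η |G(b) − G(a)|`. [folklore] -/
theorem integral_abs_shift_sub_le {G : ℝ → ℝ} (hG : Monotone G ∨ Antitone G) {a b η : ℝ}
    (hη : 0 ≤ η) (hηab : η ≤ b - a) :
    ∫ h in a..(b - η), |G (h + η) - G h| ≤ η * |G b - G a| := by
  rcases hG with hG | hG
  · have e : (fun h => |G (h + η) - G h|) = fun h => G (h + η) - G h := by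
      funext h
      exact abs_of_nonneg (sub_nonneg.mpr (hG (by linarith)))
    rw [e, abs_of_nonneg (sub_nonneg.mpr (hG (by linarith)))]
    exact integral_shift_sub_le_of_monotone hG hη
  · have hG' : Monotone fun h => -G h := fun x y hxy => neg_le_neg (hG hxy)
    have e : (fun h => |G (h + η) - G h|) = fun h => (-G (h + η)) - (-G h) := by
      funext h
      rw [abs_of_nonpos (sub_nonpos.mpr (hG (by linarith)))]
      ring
    rw [e, abs_of_nonpos (sub_nonpos.mpr (hG (by linarith)))]
    have := integral_shift_sub_le_of_monotone (a := a) (b := b) hG' hη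
    linarith

/-- A function of the form `φ ∘ ℓ` with `φ` monotone or antitone and `ℓ` affine along a line is
monotone or antitone in the line parameter. [folklore] -/
theorem monotone_or_antitone_comp_affine {φ : ℝ → ℝ} (hφ : Monotone φ ∨ Antitone φ) (u m : ℝ) :
    Monotone (fun h => φ (u + m * h)) ∨ Antitone (fun h => φ (u + m * h)) := by
  rcases le_total 0 m with hm | hm
  · have hl : Monotone fun h : ℝ => u + m * h := fun x y hxy => by nlinarith
    rcases hφ with hφ | hφ
    · exact Or.inl (hφ.comp hl)
    · exact Or.inr (hφ.comp_monotone hl)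
  · have hl : Antitone fun h : ℝ => u + m * h := fun x y hxy => by nlinarith
    rcases hφ with hφ | hφ
    · exact Or.inr (hφ.comp_antitone hl)
    · exact Or.inl (hφ.comp hl)

/-- Points of the centre near the identity lie in the unit ball: `d_K(1, (0,0,h)) = 2√|h| < 1` for
`|h| < 1/4`. [cite: CheegerKleinerNaor2011, §1.1] -/
theorem center_mem_unitBall {h : ℝ} (hh : |h| < 1 / 4) : mk 0 0 h ∈ Metric.ball (1 : HeisK) 1 := by
  rw [Metric.mem_ball, dist_comm, dist_one_left, gauge_center]
  have h1 : Real.sqrt |h| < 1 / 2 := by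
    rw [Real.sqrt_lt' (by norm_num : (0 : ℝ) < 1 / 2)]
    linarith
  linarith

/-- `d_K((0,0,h), (0,0,h+η)) = 2√η` (`η ≥ 0`). [cite: CheegerKleinerNaor2011, §1.1] -/
theorem dist_center_center (h : ℝ) {η : ℝ} (hη : 0 ≤ η) :
    dist (mk 0 0 h) (mk 0 0 (h + η)) = 2 * Real.sqrt η := by
  have e : mk 0 0 (h + η) = mk 0 0 h * mk 0 0 η := by
    rw [mul_center]; simp
  rw [e, dist_mul_center, abs_of_nonneg hη]

/-- **Quantitative central collapse in the ideal case** ([CKN §4], the model estimate (4.1) =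
"(cshs)": "Let `d_𝒫` denote a cut metric for which the cut measure is supported on cuts which are
half-spaces. Let `ε > 0`. […] for a definite fraction of the pairs of points `x₁, x₂ ∈ L`, with
`d^ℍ(x₁,x₂) = ε`, we have `d_𝒫(x₁,x₂) ≲_θ ε·d^ℍ(x₁,x₂)`", proved on arXiv p. 14 from the additivity
("length space property") of such metrics along lines). Here in the form needed for central
collapse (vertical pairs, i.e. pairs on a coset of the centre) and for the `ℓ₁^N`-valued maps of
`CheegerKleinerNaor2011_wordBall_l1Distortion`: if `f : ℍ → ℓ₁^N` is `1`-Lipschitz for `d_K` on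
`B_1(1)` and EVERY coordinate is a monotone (or antitone) function of an affine functional of the
coordinates `(a,b,c) = (x,y,2z−xy)` of [CKN] — i.e. all super-level sets of all coordinates (the
support of the cut measure, `CutConeIntegral.lean`) are half-spaces (`HeisK.halfspace`) — then for
every `ε ∈ (0, 1/4]` there is a vertical pair `x₁ = (0,0,h)`, `x₂ = (0,0,h + ε²/4)` in `B_1(1)` at
distance EXACTLY `ε` which is compressed by the factor `4ε`:
`‖f(x₁) − f(x₂)‖₁ ≤ 4ε · d_K(x₁,x₂)`. (Mechanism: along the vertical line each coordinate is
monotone, so `h ↦ f(0,0,h)` has additive `ℓ₁`-variation, of total `≤ d_K ≤ 1` across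
`|h| ≤ 1/16`; the sliding-window inequality gives `∫ ‖f(0,0,h+η) − f(0,0,h)‖₁ dh ≤ η`, while
`d_K((0,0,h),(0,0,h+η)) = 2√η` — vertical distances are only the square root of the parameter.)
[cite: CheegerKleinerNaor2011, §4 eq. (4.1) (arXiv pp. 13–14)] -/
theorem idealCase_centralCollapse {N : ℕ} (f : HeisK → Fin N → ℝ)
    (hlip : ∀ x ∈ Metric.ball (1 : HeisK) 1, ∀ y ∈ Metric.ball (1 : HeisK) 1,
      ∑ k, |f x k - f y k| ≤ dist x y)
    (hideal : ∀ k : Fin N, ∃ (α β γ : ℝ) (φ : ℝ → ℝ), (Monotone φ ∨ Antitone φ) ∧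
      ∀ p : HeisK, f p k = φ (α * p.x + β * p.y + γ * (2 * p.z - p.x * p.y)))
    {ε : ℝ} (hε : 0 < ε) (hε4 : ε ≤ 1 / 4) :
    ∃ h : ℝ, mk 0 0 h ∈ Metric.ball (1 : HeisK) 1 ∧
      mk 0 0 (h + ε ^ 2 / 4) ∈ Metric.ball (1 : HeisK) 1 ∧
      dist (mk 0 0 h) (mk 0 0 (h + ε ^ 2 / 4)) = ε ∧
      ∑ k, |f (mk 0 0 h) k - f (mk 0 0 (h + ε ^ 2 / 4)) k| ≤
        4 * ε * dist (mk 0 0 h) (mk 0 0 (h + ε ^ 2 / 4)) := by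
  -- the scale `η = ε²/4` (so that `2√η = ε`) and the window `[a, b] = [-1/16, 1/16]`
  set η : ℝ := ε ^ 2 / 4 with hη
  have hη0 : 0 < η := by positivity
  have hsqrt : Real.sqrt η = ε / 2 := by
    rw [hη, show ε ^ 2 / 4 = (ε / 2) ^ 2 by ring, Real.sqrt_sq (by linarith)]
  have hdist : ∀ h : ℝ, dist (mk 0 0 h) (mk 0 0 (h + η)) = ε := fun h => by
    rw [dist_center_center h hη0.le, hsqrt]; ring
  have hηle : η ≤ 1 / 64 := by
    rw [hη]; nlinarith
  set a : ℝ := -(1 / 16) with ha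
  set b : ℝ := 1 / 16 with hb
  -- the coordinates along the vertical line are monotone or antitone
  have hcoord : ∀ k : Fin N, ∃ G : ℝ → ℝ, (Monotone G ∨ Antitone G) ∧ ∀ h, f (mk 0 0 h) k = G h := by
    intro k
    obtain ⟨α, β, γ, φ, hφ, hf⟩ := hideal k
    refine ⟨fun h => φ (0 + (2 * γ) * h), monotone_or_antitone_comp_affine hφ 0 (2 * γ), fun h => ?_⟩
    rw [hf]
    simp only [mk_x, mk_y, mk_z]
    congr 1
    ring
  choose G hGmono hGf using hcoord
  -- the windowed integral of the `ℓ₁`-increments is at most `η · ‖f(b) − f(a)‖₁ ≤ η`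
  have hmem : ∀ h : ℝ, |h| ≤ 1 / 16 → mk 0 0 h ∈ Metric.ball (1 : HeisK) 1 := fun h hh =>
    center_mem_unitBall (by linarith)
  have htotal : ∑ k, |G k b - G k a| ≤ 1 := by
    have h1 := hlip (mk 0 0 b) (hmem b (by rw [hb, abs_of_pos (by norm_num)]))
      (mk 0 0 a) (hmem a (by rw [ha, abs_neg, abs_of_pos (by norm_num)]))
    have h2 : dist (mk 0 0 b) (mk 0 0 a) ≤ 1 := by
      have e : mk 0 0 b = mk 0 0 (a + 1 / 8) := by rw [ha, hb]; norm_num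
      rw [dist_comm, e, dist_center_center a (by norm_num : (0 : ℝ) ≤ 1 / 8)]
      have : Real.sqrt (1 / 8) ≤ 1 / 2 := by
        rw [show (1 : ℝ) / 2 = Real.sqrt ((1 / 2) ^ 2) by rw [Real.sqrt_sq (by norm_num)]]
        exact Real.sqrt_le_sqrt (by norm_num)
      linarith
    calc ∑ k, |G k b - G k a| = ∑ k, |f (mk 0 0 b) k - f (mk 0 0 a) k| := by
          simp only [hGf]
      _ ≤ 1 := h1.trans h2
  have hi : ∀ k : Fin N, IntervalIntegrable (fun h => |G k (h + η) - G k h|) volume a (b - η) := by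
    intro k
    rcases hGmono k with hm | hm
    · have h1 : Monotone fun h => G k (h + η) := fun x y hxy => hm (by linarith)
      exact ((h1.intervalIntegrable).sub hm.intervalIntegrable).abs
    · have h1 : Antitone fun h => G k (h + η) := fun x y hxy => hm (by linarith)
      exact ((h1.intervalIntegrable).sub hm.intervalIntegrable).abs
  have hisum : IntervalIntegrable (fun h => ∑ k, |G k (h + η) - G k h|) volume a (b - η) := by
    have e : (fun h => ∑ k, |G k (h + η) - G k h|) = ∑ k, fun h => |G k (h + η) - G k h| := by
      funext h
      simp only [Finset.sum_apply]
    rw [e]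
    exact IntervalIntegrable.sum Finset.univ fun k _ => hi k
  have hint : ∫ h in a..(b - η), (∑ k, |G k (h + η) - G k h|) ≤ η := by
    rw [intervalIntegral.integral_finsetSum (fun k _ => hi k)]
    calc ∑ k, ∫ h in a..(b - η), |G k (h + η) - G k h|
        ≤ ∑ k, η * |G k b - G k a| := Finset.sum_le_sum fun k _ =>
          integral_abs_shift_sub_le (hGmono k) hη0.le (by rw [ha, hb]; linarith)
      _ = η * ∑ k, |G k b - G k a| := by rw [Finset.mul_sum]
      _ ≤ η * 1 := mul_le_mul_of_nonneg_left htotal hη0.le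
      _ = η := mul_one η
  -- hence some `h ∈ [a, b − η]` has increment `≤ 4ε²`
  have hex : ∃ h ∈ Icc a (b - η), ∑ k, |G k (h + η) - G k h| ≤ 4 * ε ^ 2 := by
    by_contra hcon
    simp only [not_exists, not_and, not_le] at hcon
    have hlow : ∫ _ in a..(b - η), 4 * ε ^ 2 ≤ ∫ h in a..(b - η), (∑ k, |G k (h + η) - G k h|) :=
      intervalIntegral.integral_mono_on (by rw [ha, hb]; linarith) (by simp) hisum
        (fun h hh => (hcon h hh).le)
    rw [intervalIntegral.integral_const, smul_eq_mul] at hlow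
    have : (b - η - a) * (4 * ε ^ 2) ≤ η := hlow.trans hint
    rw [ha, hb, hη] at this
    nlinarith
  obtain ⟨h, hh, hsum⟩ := hex
  have hha : |h| ≤ 1 / 16 := by
    rw [abs_le]; rw [ha, hb] at hh; exact ⟨by linarith [hh.1], by linarith [hh.2]⟩
  have hhb : |h + η| ≤ 1 / 16 := by
    rw [abs_le]; rw [ha, hb] at hh; exact ⟨by linarith [hh.1], by linarith [hh.2]⟩
  refine ⟨h, hmem h hha, hmem (h + η) hhb, hdist h, ?_⟩
  rw [hdist h]
  calc ∑ k, |f (mk 0 0 h) k - f (mk 0 0 (h + η)) k| = ∑ k, |G k (h + η) - G k h| := by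
        refine Finset.sum_congr rfl fun k _ => ?_
        rw [hGf, hGf, abs_sub_comm]
    _ ≤ 4 * ε ^ 2 := hsum
    _ = 4 * ε * ε := by ring

/-- **The "definite fraction" form of (4.1) in the ideal case**: with `f` as in
`idealCase_centralCollapse` and `ε ∈ (0, 1/4]`, among the vertical pairs
`((0,0,h), (0,0,h+ε²/4))`, `h ∈ (−1/16, 1/16 − ε²/4]` (all in `B_1(1)`, all at distance exactly `ε`),
those NOT compressed by the factor `8ε` — i.e. with `‖f(x₁) − f(x₂)‖₁ ≥ 8ε² = 8ε·d_K(x₁,x₂)` — form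
a set of parameters of measure `≤ 1/32`, while the window has length `≥ 7/64 > 2/32`: so MORE THAN
HALF (indeed `≥ 5/7`) of these pairs are `8ε`-compressed ("for a definite fraction of the pairs of
points `x₁, x₂ ∈ L`, with `d^ℍ(x₁,x₂) = ε`, we have `d_𝒫(x₁,x₂) ≲ ε·d^ℍ(x₁,x₂)`", by Markov's
inequality applied to the sliding-window bound). [cite: CheegerKleinerNaor2011, §4 eq. (4.1) (arXiv pp. 13–14)] -/
theorem idealCase_centralCollapse_measure {N : ℕ} (f : HeisK → Fin N → ℝ)
    (hlip : ∀ x ∈ Metric.ball (1 : HeisK) 1, ∀ y ∈ Metric.ball (1 : HeisK) 1,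
      ∑ k, |f x k - f y k| ≤ dist x y)
    (hideal : ∀ k : Fin N, ∃ (α β γ : ℝ) (φ : ℝ → ℝ), (Monotone φ ∨ Antitone φ) ∧
      ∀ p : HeisK, f p k = φ (α * p.x + β * p.y + γ * (2 * p.z - p.x * p.y)))
    {ε : ℝ} (hε : 0 < ε) (hε4 : ε ≤ 1 / 4) :
    volume.real ({h : ℝ | 8 * ε ^ 2 ≤ ∑ k, |f (mk 0 0 (h + ε ^ 2 / 4)) k - f (mk 0 0 h) k|} ∩
      Set.Ioc (-(1 / 16 : ℝ)) (1 / 16 - ε ^ 2 / 4)) ≤ 1 / 32 := by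
  set η : ℝ := ε ^ 2 / 4 with hη
  have hη0 : 0 < η := by positivity
  have hηle : η ≤ 1 / 64 := by
    rw [hη]; nlinarith
  set a : ℝ := -(1 / 16) with ha
  set b : ℝ := 1 / 16 with hb
  have hle : a ≤ b - η := by rw [ha, hb]; linarith
  -- the coordinates along the vertical line are monotone or antitone
  have hcoord : ∀ k : Fin N, ∃ G : ℝ → ℝ, (Monotone G ∨ Antitone G) ∧ ∀ h, f (mk 0 0 h) k = G h := by
    intro k
    obtain ⟨α, β, γ, φ, hφ, hf⟩ := hideal k
    refine ⟨fun h => φ (0 + (2 * γ) * h), monotone_or_antitone_comp_affine hφ 0 (2 * γ), fun h => ?_⟩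
    rw [hf]
    simp only [mk_x, mk_y, mk_z]
    congr 1
    ring
  choose G hGmono hGf using hcoord
  have hmem : ∀ h : ℝ, |h| ≤ 1 / 16 → mk 0 0 h ∈ Metric.ball (1 : HeisK) 1 := fun h hh =>
    center_mem_unitBall (by linarith)
  have htotal : ∑ k, |G k b - G k a| ≤ 1 := by
    have h1 := hlip (mk 0 0 b) (hmem b (by rw [hb, abs_of_pos (by norm_num)]))
      (mk 0 0 a) (hmem a (by rw [ha, abs_neg, abs_of_pos (by norm_num)]))
    have h2 : dist (mk 0 0 b) (mk 0 0 a) ≤ 1 := by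
      have e : mk 0 0 b = mk 0 0 (a + 1 / 8) := by rw [ha, hb]; norm_num
      rw [dist_comm, e, dist_center_center a (by norm_num : (0 : ℝ) ≤ 1 / 8)]
      have : Real.sqrt (1 / 8) ≤ 1 / 2 := by
        rw [show (1 : ℝ) / 2 = Real.sqrt ((1 / 2) ^ 2) by rw [Real.sqrt_sq (by norm_num)]]
        exact Real.sqrt_le_sqrt (by norm_num)
      linarith
    calc ∑ k, |G k b - G k a| = ∑ k, |f (mk 0 0 b) k - f (mk 0 0 a) k| := by
          simp only [hGf]
      _ ≤ 1 := h1.trans h2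
  have hi : ∀ k : Fin N, IntervalIntegrable (fun h => |G k (h + η) - G k h|) volume a (b - η) := by
    intro k
    rcases hGmono k with hm | hm
    · have h1 : Monotone fun h => G k (h + η) := fun x y hxy => hm (by linarith)
      exact ((h1.intervalIntegrable).sub hm.intervalIntegrable).abs
    · have h1 : Antitone fun h => G k (h + η) := fun x y hxy => hm (by linarith)
      exact ((h1.intervalIntegrable).sub hm.intervalIntegrable).abs
  have hisum : IntervalIntegrable (fun h => ∑ k, |G k (h + η) - G k h|) volume a (b - η) := by
    have e : (fun h => ∑ k, |G k (h + η) - G k h|) = ∑ k, fun h => |G k (h + η) - G k h| := by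
      funext h
      simp only [Finset.sum_apply]
    rw [e]
    exact IntervalIntegrable.sum Finset.univ fun k _ => hi k
  have hint : ∫ h in a..(b - η), (∑ k, |G k (h + η) - G k h|) ≤ η := by
    rw [intervalIntegral.integral_finsetSum (fun k _ => hi k)]
    calc ∑ k, ∫ h in a..(b - η), |G k (h + η) - G k h|
        ≤ ∑ k, η * |G k b - G k a| := Finset.sum_le_sum fun k _ =>
          integral_abs_shift_sub_le (hGmono k) hη0.le (by rw [ha, hb]; linarith)
      _ = η * ∑ k, |G k b - G k a| := by rw [Finset.mul_sum]
      _ ≤ η * 1 := mul_le_mul_of_nonneg_left htotal hη0.le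
      _ = η := mul_one η
  -- Markov's inequality on the window
  set μ : Measure ℝ := volume.restrict (Set.Ioc a (b - η)) with hμ
  have hInt : Integrable (fun h => ∑ k, |G k (h + η) - G k h|) μ := by
    rw [hμ]
    exact (intervalIntegrable_iff_integrableOn_Ioc_of_le hle).mp hisum
  have hnn : 0 ≤ᵐ[μ] fun h => ∑ k, |G k (h + η) - G k h| :=
    Filter.Eventually.of_forall fun h => Finset.sum_nonneg fun k _ => abs_nonneg _
  have hmarkov := mul_meas_ge_le_integral_of_nonneg hnn hInt (8 * ε ^ 2)
  have hint' : ∫ h, (∑ k, |G k (h + η) - G k h|) ∂μ ≤ η := by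
    rw [hμ, ← intervalIntegral.integral_of_le hle]
    exact hint
  have hε2 : 0 < 8 * ε ^ 2 := by positivity
  have hreal : μ.real {h | 8 * ε ^ 2 ≤ ∑ k, |G k (h + η) - G k h|} ≤ 1 / 32 := by
    have h1 : 8 * ε ^ 2 * μ.real {h | 8 * ε ^ 2 ≤ ∑ k, |G k (h + η) - G k h|} ≤ ε ^ 2 / 4 :=
      hmarkov.trans hint'
    by_contra hcon
    rw [not_le] at hcon
    nlinarith
  have hset : {h : ℝ | 8 * ε ^ 2 ≤ ∑ k, |f (mk 0 0 (h + η)) k - f (mk 0 0 h) k|} =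
      {h : ℝ | 8 * ε ^ 2 ≤ ∑ k, |G k (h + η) - G k h|} := by
    ext h
    simp only [Set.mem_setOf_eq, hGf]
  rw [hset]
  rw [hμ, measureReal_restrict_apply' measurableSet_Ioc] at hreal
  exact hreal

end HeisK

end Literature.Geometry.MetricEmbeddings

end
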